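import Mathlib
import Summits.NavierStokesRegularity.FluidComputer.TransportGalerkinUniqueLimit
import Summits.NavierStokesRegularity.FluidComputer.TransportGalerkinAbcKillFinal
import HarnessLib

/-!
# Galerkin limit of the transport model, XXV: the forced-ABC KILL word about THE SMOOTH solution, unique among ALL spatially smooth classical solutions (instab g20, cell `ns-blowup`, 2026-08-27)

HONEST FRAMING (human ruling D-0035): nothing here is a claim about Navier–Stokes blow-up.
WHAT THIS IS NOT: not NS — a MODEL theorem schema about the forced-ABC perturbation equation on
`𝕋³`; its load-bearing inputs are the Lyapunov certificates of record (interval stage not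
commissioned) and, for KEEP, the certified X0 eigenvalue; no number or census word moves.

PURPOSE. The final form of the KILL entry point for certificate holders. Compared with
`TransportGalerkinAbcSolution.exists_kill_solution_abc_final` (part XVIII: existence in the order-`6`
tail class, the decay, uniqueness in that class), THE solution is here also SMOOTH IN SPACE at every time
of the window (`RapidDecay ⇑(w t)`, part XIX) and UNIQUE AMONG ALL SPATIALLY SMOOTH CLASSICAL SOLUTIONS
keeping the three clauses on `(0, T)` — no tail uniformity asked of the competitor (parts XXI–XXII, the
weak–strong `L²` argument). Hypotheses unchanged: certificate + basin data. KEEP twin: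
`TransportGalerkinAbcSmoothKeep`. Mathlib + the tree files cited; no new definitions.
-/

noncomputable section

open scoped ENNReal NNReal ComplexConjugate InnerProductSpace
open Set Filter Topology

namespace Summit.NavierStokesRegularity.FluidComputer.TransportGalerkinAbcSmoothKill

open RCLike MeasureTheory UnitAddTorus
open Literature.Analysis.FunctionSpaces Literature.Analysis.FunctionSpaces.Lattice
open Literature.Analysis.FunctionSpaces.Torus Literature.Analysis.FunctionSpaces.EuclideanSpace
open Literature.Analysis.ODE Literature.Analysis.FluidPDE
open Summit.NavierStokesRegularity.FluidComputer.TransportGalerkin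
open Summit.NavierStokesRegularity.FluidComputer.TransportGalerkinBox
open Summit.NavierStokesRegularity.FluidComputer.TransportGalerkinEigen
open Summit.NavierStokesRegularity.FluidComputer.TransportGalerkinAbc
open Summit.NavierStokesRegularity.FluidComputer.TransportGalerkinInvariance
open Summit.NavierStokesRegularity.FluidComputer.TransportGalerkinLevelSubspace
open Summit.NavierStokesRegularity.FluidComputer.TransportGalerkinLevelExistence
open Summit.NavierStokesRegularity.FluidComputer.TransportGalerkinKillLevels
open Summit.NavierStokesRegularity.FluidComputer.TransportGalerkinExistence
open Summit.NavierStokesRegularity.FluidComputer.TransportGalerkinSmooth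
open Summit.NavierStokesRegularity.FluidComputer.TransportGalerkinUniqueLimit
open Summit.NavierStokesRegularity.FluidComputer.TransportGalerkinAbcKillFinal
open Summit.NavierStokesRegularity.FluidComputer.ConvectiveProductLawBooking

/-- **KILL about THE smooth solution** (`exists_kill_solution_abc_smooth`): certificate + basin data
(`ν > 0`, `T ≥ 0`) ⟹ THE classical solution from `x` on `[0, T]` exists, is smooth in space at every `t`,
obeys `‖w t‖ ≤ 2 ε e^{λt}`, and every spatially smooth classical solution from `x` keeping the clauses on
`(0, T)` coincides with it on `[0, T]`. -/
theorem exists_kill_solution_abc_smooth (K : ℕ) (A B C : ℝ) {ν : ℝ} (hν : 0 < ν) {T : ℝ} (hT : 0 ≤ T)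
    {x : lp (fun _ : (Fin 3 → ℤ) => EuclideanSpace ℂ (Fin 3)) 2} (hxr : RapidDecay (⇑x))
    (hxfix : ∀ k, lerayCLM k (x k) = x k)
    (hxreal : ∀ (j : Fin 3) (k : Fin 3 → ℤ), (EuclideanSpace.proj j : EuclideanSpace ℂ (Fin 3) →L[ℂ] ℂ) (x (-k)) =
      conj ((EuclideanSpace.proj j : EuclideanSpace ℂ (Fin 3) →L[ℂ] ℂ) (x k)))
    (hxdiv : ∀ k : Fin 3 → ℤ, ∑ j, ((k j : ℤ) : ℂ) * (EuclideanSpace.proj j : EuclideanSpace ℂ (Fin 3) →L[ℂ] ℂ) (x k) = 0)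
    {μt : ℝ}
    {G₁ G₂ G : lp (fun _ : (Fin 3 → ℤ) => EuclideanSpace ℂ (Fin 3)) 2 →L[ℝ]
      lp (fun _ : (Fin 3 → ℤ) => EuclideanSpace ℂ (Fin 3)) 2}
    (hG₁ : ∀ x y : lp (fun _ : (Fin 3 → ℤ) => EuclideanSpace ℂ (Fin 3)) 2, ⟪G₁ x, y⟫_ℂ = ⟪x, G₁ y⟫_ℂ)
    (hG₂ : ∀ x y : lp (fun _ : (Fin 3 → ℤ) => EuclideanSpace ℂ (Fin 3)) 2, ⟪G₂ x, y⟫_ℂ = ⟪x, G₂ y⟫_ℂ)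
    (hG : ∀ x y : lp (fun _ : (Fin 3 → ℤ) => EuclideanSpace ℂ (Fin 3)) 2, ⟪G x, y⟫_ℂ = ⟪x, G y⟫_ℂ)
    (hG₁P : ∀ n, ∀ w z : lp (fun _ : (Fin 3 → ℤ) => EuclideanSpace ℂ (Fin 3)) 2,
      ⟪G₁ w, cubeProj (n + K) z⟫_ℂ = ⟪G₁ (cubeProj (n + K) w), z⟫_ℂ)
    (hG₂P : ∀ n, ∀ w z : lp (fun _ : (Fin 3 → ℤ) => EuclideanSpace ℂ (Fin 3)) 2,
      ⟪G₂ w, cubeProj (n + K) z⟫_ℂ = ⟪G₂ (cubeProj (n + K) w), z⟫_ℂ)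
    (hGP : ∀ n, ∀ w z : lp (fun _ : (Fin 3 → ℤ) => EuclideanSpace ℂ (Fin 3)) 2,
      ⟪G w, cubeProj (n + K) z⟫_ℂ = ⟪G (cubeProj (n + K) w), z⟫_ℂ)
    (hG₁pos : ∀ x : lp (fun _ : (Fin 3 → ℤ) => EuclideanSpace ℂ (Fin 3)) 2, 0 ≤ re ⟪G₁ x, x⟫_ℂ)
    {ω c m₂ M₁ : ℝ} (hc : 0 < c) (hm₂ : 0 < m₂) (hM₁ : 0 ≤ M₁)
    (hm₂' : ∀ x : lp (fun _ : (Fin 3 → ℤ) => EuclideanSpace ℂ (Fin 3)) 2, m₂ * ‖x‖ ^ 2 ≤ re ⟪G₂ x, x⟫_ℂ)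
    (hM₁' : ∀ x : lp (fun _ : (Fin 3 → ℤ) => EuclideanSpace ℂ (Fin 3)) 2,
      re ⟪G₁ x, x⟫_ℂ ≤ M₁ * (eNormSq (-1) (⇑x)).toReal)
    {m M ω₁ : ℝ} (hm0 : 0 < m)
    (hm : ∀ x : lp (fun _ : (Fin 3 → ℤ) => EuclideanSpace ℂ (Fin 3)) 2, m * ‖x‖ ^ 2 ≤ re ⟪G x, x⟫_ℂ)
    (hM : ∀ x : lp (fun _ : (Fin 3 → ℤ) => EuclideanSpace ℂ (Fin 3)) 2, re ⟪G x, x⟫_ℂ ≤ M * ‖x‖ ^ 2)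
    (h₁ : ∀ n, ∀ w : lp (fun _ : (Fin 3 → ℤ) => EuclideanSpace ℂ (Fin 3)) 2,
      2 * re ⟪G₁ (cubeProj (n + K) w), linOp ν (mFourierCoeff (EuclideanSpace.complexify ∘ Torus.abcFlow A B C))
        (fun j => (EuclideanSpace.proj j : EuclideanSpace ℂ (Fin 3) →L[ℂ] ℂ)) lerayCLM (cubeProj (n + K) w)⟫_ℂ +
        c * re ⟪G₂ (cubeProj (n + K) w), cubeProj (n + K) w⟫_ℂ ≤ 2 * ω * re ⟪G₁ (cubeProj (n + K) w), cubeProj (n + K) w⟫_ℂ)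
    (h₂ : ∀ n, ∀ w : lp (fun _ : (Fin 3 → ℤ) => EuclideanSpace ℂ (Fin 3)) 2,
      re ⟪G₂ (cubeProj (n + K) w), linOp ν (mFourierCoeff (EuclideanSpace.complexify ∘ Torus.abcFlow A B C))
        (fun j => (EuclideanSpace.proj j : EuclideanSpace ℂ (Fin 3) →L[ℂ] ℂ)) lerayCLM (cubeProj (n + K) w)⟫_ℂ ≤
        ω * re ⟪G₂ (cubeProj (n + K) w), cubeProj (n + K) w⟫_ℂ)
    (hL : ∀ n, ∀ w : lp (fun _ : (Fin 3 → ℤ) => EuclideanSpace ℂ (Fin 3)) 2,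
      re ⟪G (cubeProj (n + K) w), linOp ν (mFourierCoeff (EuclideanSpace.complexify ∘ Torus.abcFlow A B C))
        (fun j => (EuclideanSpace.proj j : EuclideanSpace ℂ (Fin 3) →L[ℂ] ℂ)) lerayCLM (cubeProj (n + K) w)⟫_ℂ ≤
        ω₁ * re ⟪G (cubeProj (n + K) w), cubeProj (n + K) w⟫_ℂ)
    (hμ₁ : μt ≤ ω₁) (hμ₂ : μt ≤ ω)
    (htail : ∀ n, ∀ q : lp (fun _ : (Fin 3 → ℤ) => EuclideanSpace ℂ (Fin 3)) 2, cubeProj (n + K) q = 0 →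
      2 * μt * re ⟪G₁ q, q⟫_ℂ + c * re ⟪G₂ q, q⟫_ℂ ≤ 2 * ω * re ⟪G₁ q, q⟫_ℂ)
    {lam : ℝ} (hgap : ω < 2 * lam) (hlam : lam ≤ 0) (hrate : ω₁ ≤ lam)
    {ε : ℝ} (hε : 0 < ε) (hseed : Real.sqrt (M / m) * ‖x‖ < ε)
    (hbasin : 4 * (Real.sqrt (M₁ / (c * m₂)) * (2 * ((Fintype.card (Fin 3) : ℝ) * (2 * Real.pi)) *
        Real.sqrt ((∑' l : Fin 3 → ℤ, ENNReal.ofReal (sobolevWeight (-2) l ^ 2)).toReal)) *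
        Real.sqrt (Real.pi / (2 * lam - ω))) * ε < 1) :
    -- THE smooth solution: existence, smoothness, the decay, uniqueness among smooth solutions
    ∃ w : ℝ → lp (fun _ : (Fin 3 → ℤ) => EuclideanSpace ℂ (Fin 3)) 2,
      ContinuousOn w (Icc 0 T) ∧ w 0 = x ∧
      (∀ t ∈ Ioo 0 T, HasDerivAt w (nsField ν (mFourierCoeff (EuclideanSpace.complexify ∘ Torus.abcFlow A B C))
            (fun j => (EuclideanSpace.proj j : EuclideanSpace ℂ (Fin 3) →L[ℂ] ℂ)) lerayCLM (w t)) t) ∧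
      (∀ t ∈ Icc 0 T, RapidDecay (⇑(w t))) ∧
      (∃ Cw : ℝ, 0 ≤ Cw ∧ ∀ t ∈ Icc 0 T, ∀ k, ‖(w t : (Fin 3 → ℤ) → EuclideanSpace ℂ (Fin 3)) k‖ ≤
        Cw * sobolevWeight (-((Fintype.card (Fin 3) : ℝ) + 3)) k) ∧
      (∀ t ∈ Icc 0 T, ∀ k, lerayCLM k ((w t : (Fin 3 → ℤ) → EuclideanSpace ℂ (Fin 3)) k) =
        (w t : (Fin 3 → ℤ) → EuclideanSpace ℂ (Fin 3)) k) ∧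
      (∀ t ∈ Icc 0 T, ∀ (j : Fin 3) (k : Fin 3 → ℤ),
        (EuclideanSpace.proj j : EuclideanSpace ℂ (Fin 3) →L[ℂ] ℂ) ((w t : (Fin 3 → ℤ) → EuclideanSpace ℂ (Fin 3)) (-k)) =
          conj ((EuclideanSpace.proj j : EuclideanSpace ℂ (Fin 3) →L[ℂ] ℂ) ((w t : (Fin 3 → ℤ) → EuclideanSpace ℂ (Fin 3)) k))) ∧
      (∀ t ∈ Icc 0 T, ∀ k : Fin 3 → ℤ,
        ∑ j, ((k j : ℤ) : ℂ) * (EuclideanSpace.proj j : EuclideanSpace ℂ (Fin 3) →L[ℂ] ℂ)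
          ((w t : (Fin 3 → ℤ) → EuclideanSpace ℂ (Fin 3)) k) = 0) ∧
      (∀ t ∈ Icc 0 T, ‖w t‖ ≤ 2 * (ε * Real.exp (lam * t))) ∧
      -- uniqueness among ALL spatially smooth classical solutions keeping the clauses
      ∀ {w' : ℝ → lp (fun _ : (Fin 3 → ℤ) => EuclideanSpace ℂ (Fin 3)) 2} (_hw' : ContinuousOn w' (Icc 0 T))
        (_hw'0 : w' 0 = x)
        (_hw'' : ∀ t ∈ Ioo 0 T, HasDerivAt w' (nsField ν (mFourierCoeff (EuclideanSpace.complexify ∘ Torus.abcFlow A B C))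
            (fun j => (EuclideanSpace.proj j : EuclideanSpace ℂ (Fin 3) →L[ℂ] ℂ)) lerayCLM (w' t)) t)
        (_hw'r : ∀ t ∈ Ioo 0 T, RapidDecay (⇑(w' t)))
        (_hw'fix : ∀ t ∈ Ioo 0 T, ∀ k, lerayCLM k ((w' t : (Fin 3 → ℤ) → EuclideanSpace ℂ (Fin 3)) k) =
          (w' t : (Fin 3 → ℤ) → EuclideanSpace ℂ (Fin 3)) k)
        (_hw'real : ∀ t ∈ Ioo 0 T, ∀ (j : Fin 3) (k : Fin 3 → ℤ),
          (EuclideanSpace.proj j : EuclideanSpace ℂ (Fin 3) →L[ℂ] ℂ) ((w' t : (Fin 3 → ℤ) → EuclideanSpace ℂ (Fin 3)) (-k)) =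
            conj ((EuclideanSpace.proj j : EuclideanSpace ℂ (Fin 3) →L[ℂ] ℂ) ((w' t : (Fin 3 → ℤ) → EuclideanSpace ℂ (Fin 3)) k)))
        (_hw'div : ∀ t ∈ Ioo 0 T, ∀ k : Fin 3 → ℤ,
          ∑ j, ((k j : ℤ) : ℂ) * (EuclideanSpace.proj j : EuclideanSpace ℂ (Fin 3) →L[ℂ] ℂ)
            ((w' t : (Fin 3 → ℤ) → EuclideanSpace ℂ (Fin 3)) k) = 0),
        EqOn w' w (Icc 0 T) := by
  -- the Galerkin levels of the seed and the KILL ceiling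
  have hUreal : IsConjSymm (mFourierCoeff (EuclideanSpace.complexify ∘ Torus.abcFlow A B C)) :=
    (isConjSymm_iff_proj _).2 (abcHost_real A B C)
  have hxS : ∀ N, cubeProj N x ∈ levelSubspace N := fun N => by
    have hz : x ∈ box (fun k => ‖(x : (Fin 3 → ℤ) → EuclideanSpace ℂ (Fin 3)) k‖)
        (fun j => (EuclideanSpace.proj j : EuclideanSpace ℂ (Fin 3) →L[ℂ] ℂ)) lerayCLM :=
      mem_box.2 ⟨fun k => le_rfl, hxfix, hxreal, hxdiv⟩
    have h := cubeProj_mem_box hz N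
    exact ⟨lpProj_idem _ _, h.2.1, h.2.2.1, h.2.2.2⟩
  have hsol := fun n => exists_level_solution (ν := ν) hν.le (rapidDecay_abcHost A B C) hUreal (abcHost_div A B C)
    (n + K) (hxS (n + K))
  choose u hu0 hu' hucont humem using hsol
  -- the level data, named once
  have sc : ∀ n, ContinuousOn (u n) (Icc 0 T) := fun n t ht => (hu' n T t ht).continuousWithinAt
  have sd : ∀ n, ∀ t ∈ Icc 0 T, HasDerivWithinAt (u n) (cubeProj (n + K) (nsField ν (mFourierCoeff (EuclideanSpace.complexify ∘ Torus.abcFlow A B C))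
        (fun j => (EuclideanSpace.proj j : EuclideanSpace ℂ (Fin 3) →L[ℂ] ℂ)) lerayCLM (u n t))) (Icc 0 T) t :=
    fun n t ht => hu' n T t ht
  have sp : ∀ n, ∀ t ∈ Icc 0 T, cubeProj (n + K) (u n t) = u n t := fun n t _ => (humem n t).1
  have sf : ∀ n, ∀ t ∈ Icc 0 T, ∀ k, lerayCLM k ((u n t : (Fin 3 → ℤ) → EuclideanSpace ℂ (Fin 3)) k) =
      (u n t : (Fin 3 → ℤ) → EuclideanSpace ℂ (Fin 3)) k := fun n t _ => (humem n t).2.1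
  have sr : ∀ n, ∀ t ∈ Icc 0 T, ∀ (j : Fin 3) (k : Fin 3 → ℤ),
      (EuclideanSpace.proj j : EuclideanSpace ℂ (Fin 3) →L[ℂ] ℂ) ((u n t : (Fin 3 → ℤ) → EuclideanSpace ℂ (Fin 3)) (-k)) =
        conj ((EuclideanSpace.proj j : EuclideanSpace ℂ (Fin 3) →L[ℂ] ℂ) ((u n t : (Fin 3 → ℤ) → EuclideanSpace ℂ (Fin 3)) k)) :=
    fun n t _ => (humem n t).2.2.1
  have sv : ∀ n, ∀ t ∈ Icc 0 T, ∀ k : Fin 3 → ℤ,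
      ∑ j, ((k j : ℤ) : ℂ) * (EuclideanSpace.proj j : EuclideanSpace ℂ (Fin 3) →L[ℂ] ℂ)
        ((u n t : (Fin 3 → ℤ) → EuclideanSpace ℂ (Fin 3)) k) = 0 := fun n t _ => (humem n t).2.2.2
  have hbound : ∀ n, ∀ t ∈ Icc 0 T, ‖u n t‖ ≤ 2 * ε := by
    intro n t ht
    have h := levelBound_kill K (rapidDecay_abcHost A B C) TransportGalerkinAbc.norm_proj_le norm_lerayCLM_le
      (tsum_sobolevWeight_neg_two_sq_lt_top (Fintype.card_fin 3).le) (u := u)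
      sc (fun n => hu0 n) sd (fun n => hucont n T) sp
      hG₁ hG₂ hG hG₁P hG₂P hGP hG₁pos hc hm₂ hM₁ hm₂' hM₁' hm0 hm hM h₁ h₂ hL hμ₁ hμ₂ htail hgap hlam hrate hε
      hseed hbasin n t ht
    have hexp : Real.exp (lam * t) ≤ 1 := by
      rw [← Real.exp_zero]; exact Real.exp_le_exp.2 (mul_nonpos_of_nonpos_of_nonneg hlam ht.1)
    nlinarith [h, hexp, hε]
  have hr : (0 : ℝ) < 2 * ε := by positivity
  -- THE solution, its smoothness, the decay, uniqueness among smooth solutions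
  obtain ⟨w, hconv, hw, hw0, hw', ⟨Cw, hCw, hwdec⟩, hwfix, hwreal, hwdiv⟩ :=
    exists_solution_of_levelBound K hν (rapidDecay_abcHost A B C) (abcHost_real A B C) (abcHost_div A B C)
      TransportGalerkinAbc.norm_proj_le isSelfAdjoint_lerayCLM norm_lerayCLM_le
      (tsum_sobolevWeight_neg_two_sq_lt_top (Fintype.card_fin 3).le) hT hxr hxfix hxreal hxdiv hr
      (u := u) sc (fun n => hu0 n) sd sp sf sr sv hbound
  have hsmooth := (smooth_of_tendstoUniformlyOn K hν (rapidDecay_abcHost A B C) (abcHost_real A B C) (abcHost_div A B C)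
      TransportGalerkinAbc.norm_proj_le isSelfAdjoint_lerayCLM norm_lerayCLM_le
      (tsum_sobolevWeight_neg_two_sq_lt_top (Fintype.card_fin 3).le) hxr hr
      (u := u) sc (fun n => hu0 n) sd sp sf sr sv hbound hconv).2
  refine ⟨w, hw, hw0, hw', hsmooth, ⟨Cw, hCw, hwdec⟩, hwfix, hwreal, hwdiv, ?_, ?_⟩
  · exact decay_two_abc_final K A B C hν hT hxr hxfix hxreal hxdiv hG₁ hG₂ hG hG₁P hG₂P hGP hG₁pos hc hm₂ hM₁
      hm₂' hM₁' hm0 hm hM h₁ h₂ hL hμ₁ hμ₂ htail hgap hlam hrate hε hseed hbasin hw hw0 hw' hCw hwdec hwfix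
      hwreal hwdiv
  · intro w' hw'c hw'0 hw'' hw'r hw'fix hw'real hw'div t ht
    have h : TendstoUniformlyOn (fun n t => u n t) w' atTop (Icc 0 T) :=
      tendstoUniformlyOn_of_smooth_solution K hν (rapidDecay_abcHost A B C) (abcHost_real A B C)
      (abcHost_div A B C) TransportGalerkinAbc.norm_proj_le isSelfAdjoint_lerayCLM norm_lerayCLM_le
      (tsum_sobolevWeight_neg_two_sq_lt_top (Fintype.card_fin 3).le) hT hxr hxfix hxreal hxdiv hr
      (u := u) sc (fun n => hu0 n) sd sp sf sr sv hbound hw'c hw'0 hw'' hw'r hw'fix hw'real hw'div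
    exact eqOn_of_two_uniform_limits h hconv ht

end Summit.NavierStokesRegularity.FluidComputer.TransportGalerkinAbcSmoothKill

end
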